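import Mathlib
import HarnessLib
import Summits.HubbardSuperconductivity.HubbardSuperconductivity.Theorems.KLProgrammeKLRegimeVolumeLimitCauchy
import Summits.HubbardSuperconductivity.HubbardSuperconductivity.Theorems.KLProgrammeKLRegimeEngineTwoShellLatticeCount

/-!
# Route `KLProgramme` — ENGINE item stmt-HubbardSuperconductivity-20437 `KLRegimeEngineV17F2`, class-#5 STEP (X).3 rows form / (c) `hout` rows:
# PERIODIC LIPSCHITZ EXTENSION OF LATTICE DATA — a function on the momentum torus `TorusSite 2 L` with a sup bound and a torus-Lipschitz
# constant extends to a doubly `2π`-periodic continuous Lipschitz function on the plane `ℝ × ℝ` (McShane's formula on the finite lattice, clamped)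
# (cell gate-hubbard-kl, seat hubbard-kl-k3c2-p2 g17)

WHY.  The signed lattice ph-loop rows (`klfl_lattice_forward_bubble_norm_le`, `klhl_lattice_soft_split_norm_le`, …) take their vertex weights
`A`, `R_i` as doubly `2π`-periodic continuous Lipschitz functions on `ℝ × ℝ`, read at the lattice momenta `(p_k̃ 0, p_k̃ 1)`; the STEP's kernel
products are functions of the LATTICE loop label `k̃ : TorusSite 2 L` only.  This file closes the gap once and for all:

* §1 torus sup-norm bookkeeping on the plane (`klpe_tau_*`: `|p − q|_𝕋 ≤ dist p q`, periodicity, triangle inequality, the lattice dictionary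
  `|p_k̃ − p_k̃′|_𝕋 = klTorusNorm L (k̃ − k̃′)`);
* §2 the real McShane extension `klpeExtR g K p = ⊓_k̃ (g k̃ + K·|p − p_k̃|_𝕋)` clamped to `[−B, B]`: agrees with `g` on the lattice, `|·| ≤ B`,
  `K`-Lipschitz in the sup metric, periodic, continuous (`klpe_extR_*`);
* §3 the complex extension `klpeExt g B K` (real and imaginary parts): **`klpe_ext_apply_lattice`**, **`klpe_norm_ext_le`** (`≤ 2B`),
  **`klpe_ext_lipschitz`** (`2K`), **`klpe_ext_periodic₁/₂`**, **`klpe_continuous_ext`**, packaged as **`klpe_exists_periodic_lipschitz_extension`**.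

Pure analysis; nothing about the model is asserted; nothing asserts (X).3, (c), K3 or superconductivity.
-/

noncomputable section

namespace Summit.HubbardSuperconductivity.HubbardSuperconductivity.Theorems.KLRegimeSplit

set_option linter.dupNamespace false -- summit = problem name (single-conjunct summit), D-0017

open Real Set Finset Literature.MathematicalPhysics.QuantumLattice
open Literature.Probability.LatticeModels hiding torusSupNorm
open Summit.HubbardSuperconductivity.HubbardSuperconductivity.Theorems.KLProgrammeLegKernels
open Summit.HubbardSuperconductivity.HubbardSuperconductivity.Theorems.EngineV8

/-! ## §1 The torus sup-norm on the plane -/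

/-- The planar chart of a lattice momentum: `P k̃ = (p_k̃ 0, p_k̃ 1)`. -/
def klpeP (L : ℕ) (k : TorusSite 2 L) : ℝ × ℝ := (latticeMomentum L k 0, latticeMomentum L k 1)

/-- `|p − q|_𝕋 ≤ dist p q` (sup metric on `ℝ × ℝ`). -/
theorem klpe_tau_sub_le_dist (p q : ℝ × ℝ) : torusSupNorm (p - q) ≤ dist p q := by
  unfold torusSupNorm
  rw [Prod.dist_eq, Real.dist_eq, Real.dist_eq]
  exact max_le_max (klvc_torusAbs_le_abs _) (klvc_torusAbs_le_abs _)

/-- `|−w|_𝕋 = |w|_𝕋`. -/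
theorem klpe_tau_neg (w : ℝ × ℝ) : torusSupNorm (-w) = torusSupNorm w := by
  unfold torusSupNorm; simp only [Prod.fst_neg, Prod.snd_neg, klvc_torusAbs_neg]

/-- `|a + b|_𝕋 ≤ |a|_𝕋 + |b|_𝕋`. -/
theorem klpe_tau_add_le (a b : ℝ × ℝ) : torusSupNorm (a + b) ≤ torusSupNorm a + torusSupNorm b := by
  unfold torusSupNorm
  simp only [Prod.fst_add, Prod.snd_add]
  refine max_le ?_ ?_
  · exact (klvc_torusAbs_add_le _ _).trans (add_le_add (le_max_left _ _) (le_max_left _ _))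
  · exact (klvc_torusAbs_add_le _ _).trans (add_le_add (le_max_right _ _) (le_max_right _ _))

/-- `||p − c|_𝕋 − |q − c|_𝕋| ≤ |p − q|_𝕋`. -/
theorem klpe_abs_tau_sub_tau_le (p q c : ℝ × ℝ) : |torusSupNorm (p - c) - torusSupNorm (q - c)| ≤ torusSupNorm (p - q) := by
  rw [abs_sub_le_iff]
  constructor
  · have h := klpe_tau_add_le (p - q) (q - c)
    rw [sub_add_sub_cancel] at h; linarith
  · have h := klpe_tau_add_le (q - p) (p - c)
    rw [sub_add_sub_cancel, ← neg_sub p q, klpe_tau_neg] at h; linarith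

/-- Periodicity: `|w + (2π, 0)|_𝕋 = |w|_𝕋`, `|w + (0, 2π)|_𝕋 = |w|_𝕋`. -/
theorem klpe_tau_add_two_pi (w : ℝ × ℝ) :
    torusSupNorm (w + (2 * π, 0)) = torusSupNorm w ∧ torusSupNorm (w + (0, 2 * π)) = torusSupNorm w := by
  unfold torusSupNorm
  have h1 : torusAbs (w.1 + 2 * π) = torusAbs w.1 := by simpa using klvr_torusAbs_add_int_mul w.1 1
  have h2 : torusAbs (w.2 + 2 * π) = torusAbs w.2 := by simpa using klvr_torusAbs_add_int_mul w.2 1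
  simp only [Prod.fst_add, Prod.snd_add, add_zero, h1, h2, and_self]

/-- `|x + 2πm|_𝕋 = |x|_𝕋` coordinatewise for an integer vector. -/
theorem klpe_tau_add_int_vec (w : ℝ × ℝ) (z : Fin 2 → ℤ) :
    torusSupNorm (w.1 + 2 * π * (z 0 : ℝ), w.2 + 2 * π * (z 1 : ℝ)) = torusSupNorm w := by
  unfold torusSupNorm
  have h1 : torusAbs (w.1 + 2 * π * (z 0 : ℝ)) = torusAbs w.1 := by
    rw [show w.1 + 2 * π * (z 0 : ℝ) = w.1 + (z 0 : ℝ) * (2 * π) by ring]; exact klvr_torusAbs_add_int_mul w.1 (z 0)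
  have h2 : torusAbs (w.2 + 2 * π * (z 1 : ℝ)) = torusAbs w.2 := by
    rw [show w.2 + 2 * π * (z 1 : ℝ) = w.2 + (z 1 : ℝ) * (2 * π) by ring]; exact klvr_torusAbs_add_int_mul w.2 (z 1)
  rw [h1, h2]

/-- **Lattice dictionary**: `|P k̃ − P k̃′|_𝕋 = klTorusNorm L (k̃ − k̃′)`. -/
theorem klpe_tau_P_sub_P {L : ℕ} [NeZero L] (k k' : TorusSite 2 L) :
    torusSupNorm (klpeP L k - klpeP L k') = klTorusNorm L (k - k') := by
  obtain ⟨z, hz⟩ := latticeMomentum_sub_eq k k'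
  unfold klTorusNorm klpeP
  have e : ((latticeMomentum L (k - k') 0, latticeMomentum L (k - k') 1) : ℝ × ℝ) =
      ((latticeMomentum L k 0 - latticeMomentum L k' 0) + 2 * π * (z 0 : ℝ), (latticeMomentum L k 1 - latticeMomentum L k' 1) + 2 * π * (z 1 : ℝ)) := by
    rw [hz]
  rw [e]
  exact (klpe_tau_add_int_vec ((latticeMomentum L k 0 - latticeMomentum L k' 0, latticeMomentum L k 1 - latticeMomentum L k' 1)) z).symm

/-! ## §2 The real McShane extension on the finite lattice, clamped -/

section Real

variable {L : ℕ} [NeZero L]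

/-- McShane's formula on the lattice: `⊓_k̃ (g k̃ + K·|p − P k̃|_𝕋)`. -/
def klpeInf (g : TorusSite 2 L → ℝ) (K : ℝ) (p : ℝ × ℝ) : ℝ :=
  Finset.univ.inf' Finset.univ_nonempty fun k => g k + K * torusSupNorm (p - klpeP L k)

/-- **The clamped real extension** `klpeExtR g B K p = max (−B) (min B (⊓_k̃ (g k̃ + K·|p − P k̃|_𝕋)))`. -/
def klpeExtR (g : TorusSite 2 L → ℝ) (B K : ℝ) (p : ℝ × ℝ) : ℝ := max (-B) (min B (klpeInf g K p))

/-- The infimum agrees with `g` on the lattice (`g` `K`-Lipschitz for the torus norm). -/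
theorem klpe_inf_apply_lattice {g : TorusSite 2 L → ℝ} {K : ℝ} (hg : ∀ k k', |g k - g k'| ≤ K * klTorusNorm L (k - k'))
    (k₀ : TorusSite 2 L) : klpeInf g K (klpeP L k₀) = g k₀ := by
  unfold klpeInf
  refine le_antisymm ?_ ?_
  · refine (Finset.inf'_le _ (Finset.mem_univ k₀)).trans ?_
    rw [sub_self]
    unfold torusSupNorm
    simp [klvc_torusAbs_zero]
  · refine Finset.le_inf' _ _ fun k _ => ?_
    rw [klpe_tau_P_sub_P]
    have h := hg k₀ k
    rw [abs_le] at h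
    linarith [h.1]

/-- The infimum is `K`-Lipschitz for the torus norm, hence for the sup metric (`0 ≤ K`). -/
theorem klpe_inf_lipschitz (g : TorusSite 2 L → ℝ) {K : ℝ} (hK : 0 ≤ K) (p q : ℝ × ℝ) :
    |klpeInf g K p - klpeInf g K q| ≤ K * torusSupNorm (p - q) := by
  unfold klpeInf
  -- one-sided bound: `inf f ≤ inf g + C` whenever `f k ≤ g k + C` for all `k`
  have key : ∀ (p q : ℝ × ℝ),
      Finset.univ.inf' Finset.univ_nonempty (fun k => g k + K * torusSupNorm (p - klpeP L k)) ≤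
        Finset.univ.inf' Finset.univ_nonempty (fun k => g k + K * torusSupNorm (q - klpeP L k)) + K * torusSupNorm (p - q) := by
    intro p q
    obtain ⟨k, -, hk⟩ := Finset.exists_mem_eq_inf' (s := (Finset.univ : Finset (TorusSite 2 L))) Finset.univ_nonempty
      (fun k => g k + K * torusSupNorm (q - klpeP L k))
    rw [hk]
    refine (Finset.inf'_le _ (Finset.mem_univ k)).trans ?_
    have h := klpe_abs_tau_sub_tau_le p q (klpeP L k)
    rw [abs_le] at h
    nlinarith [h.2]
  rw [abs_le]
  constructor
  · have h := key q p
    rw [← neg_sub p q, klpe_tau_neg] at h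
    linarith
  · linarith [key p q]

/-- **The clamped extension agrees with `g` on the lattice** (`|g| ≤ B`). -/
theorem klpe_extR_apply_lattice {g : TorusSite 2 L → ℝ} {B K : ℝ} (hgB : ∀ k, |g k| ≤ B)
    (hg : ∀ k k', |g k - g k'| ≤ K * klTorusNorm L (k - k')) (k₀ : TorusSite 2 L) : klpeExtR g B K (klpeP L k₀) = g k₀ := by
  unfold klpeExtR
  rw [klpe_inf_apply_lattice hg]
  have h := hgB k₀
  rw [abs_le] at h
  rw [min_eq_right h.2, max_eq_right h.1]

/-- `|klpeExtR g B K p| ≤ B` (`0 ≤ B`). -/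
theorem klpe_abs_extR_le (g : TorusSite 2 L → ℝ) {B : ℝ} (hB : 0 ≤ B) (K : ℝ) (p : ℝ × ℝ) : |klpeExtR g B K p| ≤ B := by
  unfold klpeExtR
  rw [abs_le]
  exact ⟨le_max_left _ _, max_le (by linarith) (min_le_left _ _)⟩

/-- **The clamped extension is `K`-Lipschitz in the sup metric** (`0 ≤ K`; clamping is `1`-Lipschitz). -/
theorem klpe_extR_lipschitz (g : TorusSite 2 L → ℝ) (B : ℝ) {K : ℝ} (hK : 0 ≤ K) (p q : ℝ × ℝ) :
    |klpeExtR g B K p - klpeExtR g B K q| ≤ K * dist p q := by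
  unfold klpeExtR
  have h1 := abs_max_sub_max_le_max (-B) (min B (klpeInf g K p)) (-B) (min B (klpeInf g K q))
  have h2 := abs_min_sub_min_le_max B (klpeInf g K p) B (klpeInf g K q)
  simp only [sub_self, abs_zero] at h1 h2
  have h3 := (klpe_inf_lipschitz g hK p q).trans (mul_le_mul_of_nonneg_left (klpe_tau_sub_le_dist p q) hK)
  have h0 : 0 ≤ K * dist p q := mul_nonneg hK dist_nonneg
  calc |max (-B) (min B (klpeInf g K p)) - max (-B) (min B (klpeInf g K q))|
      ≤ max 0 |min B (klpeInf g K p) - min B (klpeInf g K q)| := h1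
    _ ≤ max 0 (max 0 |klpeInf g K p - klpeInf g K q|) := max_le_max le_rfl h2
    _ ≤ K * dist p q := max_le h0 (max_le h0 h3)

/-- Periodicity of the clamped extension. -/
theorem klpe_extR_periodic (g : TorusSite 2 L → ℝ) (B K : ℝ) (x y : ℝ) :
    klpeExtR g B K (x + 2 * π, y) = klpeExtR g B K (x, y) ∧ klpeExtR g B K (x, y + 2 * π) = klpeExtR g B K (x, y) := by
  have e1 : klpeInf g K (x + 2 * π, y) = klpeInf g K (x, y) := by
    unfold klpeInf
    congr 1; funext k
    have h := (klpe_tau_add_two_pi ((x, y) - klpeP L k)).1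
    rw [show ((x + 2 * π, y) : ℝ × ℝ) - klpeP L k = ((x, y) - klpeP L k) + (2 * π, 0) by ext <;> simp [add_sub_right_comm], h]
  have e2 : klpeInf g K (x, y + 2 * π) = klpeInf g K (x, y) := by
    unfold klpeInf
    congr 1; funext k
    have h := (klpe_tau_add_two_pi ((x, y) - klpeP L k)).2
    rw [show ((x, y + 2 * π) : ℝ × ℝ) - klpeP L k = ((x, y) - klpeP L k) + (0, 2 * π) by ext <;> simp [add_sub_right_comm], h]
  unfold klpeExtR
  rw [e1, e2]
  exact ⟨rfl, rfl⟩

/-- Continuity of the clamped extension (`0 ≤ K`). -/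
theorem klpe_continuous_extR (g : TorusSite 2 L → ℝ) (B : ℝ) {K : ℝ} (hK : 0 ≤ K) : Continuous (klpeExtR g B K) :=
  (LipschitzWith.of_dist_le_mul (K := ⟨K, hK⟩) fun p q => by
    rw [Real.dist_eq]; exact klpe_extR_lipschitz g B hK p q).continuous

end Real

/-! ## §3 The complex extension -/

section Complex

variable {L : ℕ} [NeZero L]

/-- **The complex periodic Lipschitz extension**: real and imaginary parts extended separately. -/
def klpeExt (g : TorusSite 2 L → ℂ) (B K : ℝ) (p : ℝ × ℝ) : ℂ :=
  ((klpeExtR (fun k => (g k).re) B K p : ℝ) : ℂ) + ((klpeExtR (fun k => (g k).im) B K p : ℝ) : ℂ) * Complex.I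

omit [NeZero L] in
/-- Real parts inherit the sup bound and the Lipschitz constant. -/
theorem klpe_re_data {g : TorusSite 2 L → ℂ} {B K : ℝ} (hgB : ∀ k, ‖g k‖ ≤ B) (hg : ∀ k k', ‖g k - g k'‖ ≤ K * klTorusNorm L (k - k')) :
    (∀ k, |(g k).re| ≤ B) ∧ (∀ k k', |(g k).re - (g k').re| ≤ K * klTorusNorm L (k - k')) ∧
    (∀ k, |(g k).im| ≤ B) ∧ (∀ k k', |(g k).im - (g k').im| ≤ K * klTorusNorm L (k - k')) :=
  ⟨fun k => (Complex.abs_re_le_norm _).trans (hgB k), fun k k' => by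
      rw [← Complex.sub_re]; exact (Complex.abs_re_le_norm _).trans (hg k k'),
    fun k => (Complex.abs_im_le_norm _).trans (hgB k), fun k k' => by
      rw [← Complex.sub_im]; exact (Complex.abs_im_le_norm _).trans (hg k k')⟩

/-- **Agreement on the lattice**: `klpeExt g B K (P k̃) = g k̃` (`‖g‖ ≤ B`, `g` `K`-Lipschitz for the torus norm, `0 ≤ K`). -/
theorem klpe_ext_apply_lattice {g : TorusSite 2 L → ℂ} {B K : ℝ} (hgB : ∀ k, ‖g k‖ ≤ B)
    (hg : ∀ k k', ‖g k - g k'‖ ≤ K * klTorusNorm L (k - k')) (k₀ : TorusSite 2 L) : klpeExt g B K (klpeP L k₀) = g k₀ := by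
  obtain ⟨h1, h2, h3, h4⟩ := klpe_re_data hgB hg
  unfold klpeExt
  rw [klpe_extR_apply_lattice h1 h2, klpe_extR_apply_lattice h3 h4]
  exact Complex.re_add_im (g k₀)

/-- The same at the coordinates `(p_k̃ 0, p_k̃ 1)` (the form the lattice rows read). -/
theorem klpe_ext_apply_latticeMomentum {g : TorusSite 2 L → ℂ} {B K : ℝ} (hgB : ∀ k, ‖g k‖ ≤ B)
    (hg : ∀ k k', ‖g k - g k'‖ ≤ K * klTorusNorm L (k - k')) (k₀ : TorusSite 2 L) :
    klpeExt g B K (latticeMomentum L k₀ 0, latticeMomentum L k₀ 1) = g k₀ :=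
  klpe_ext_apply_lattice hgB hg k₀

/-- **Sup bound**: `‖klpeExt g B K p‖ ≤ 2B` (`0 ≤ B`). -/
theorem klpe_norm_ext_le (g : TorusSite 2 L → ℂ) {B : ℝ} (hB : 0 ≤ B) (K : ℝ) (p : ℝ × ℝ) : ‖klpeExt g B K p‖ ≤ 2 * B := by
  unfold klpeExt
  refine (norm_add_le _ _).trans ?_
  rw [norm_mul, Complex.norm_I, mul_one, Complex.norm_real, Complex.norm_real, Real.norm_eq_abs, Real.norm_eq_abs]
  linarith [klpe_abs_extR_le (fun k => (g k).re) hB K p, klpe_abs_extR_le (fun k => (g k).im) hB K p]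

/-- **Lipschitz**: `‖klpeExt g B K p − klpeExt g B K q‖ ≤ 2K·dist p q` (`0 ≤ K`). -/
theorem klpe_ext_lipschitz (g : TorusSite 2 L → ℂ) (B : ℝ) {K : ℝ} (hK : 0 ≤ K) (p q : ℝ × ℝ) :
    ‖klpeExt g B K p - klpeExt g B K q‖ ≤ 2 * K * dist p q := by
  unfold klpeExt
  have e : (((klpeExtR (fun k => (g k).re) B K p : ℝ) : ℂ) + ((klpeExtR (fun k => (g k).im) B K p : ℝ) : ℂ) * Complex.I) -
      (((klpeExtR (fun k => (g k).re) B K q : ℝ) : ℂ) + ((klpeExtR (fun k => (g k).im) B K q : ℝ) : ℂ) * Complex.I) =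
      (((klpeExtR (fun k => (g k).re) B K p - klpeExtR (fun k => (g k).re) B K q : ℝ)) : ℂ) +
        (((klpeExtR (fun k => (g k).im) B K p - klpeExtR (fun k => (g k).im) B K q : ℝ)) : ℂ) * Complex.I := by
    push_cast; ring
  rw [e]
  refine (norm_add_le _ _).trans ?_
  rw [norm_mul, Complex.norm_I, mul_one, Complex.norm_real, Complex.norm_real, Real.norm_eq_abs, Real.norm_eq_abs]
  linarith [klpe_extR_lipschitz (fun k => (g k).re) B hK p q, klpe_extR_lipschitz (fun k => (g k).im) B hK p q]

/-- **Periodicity** (first coordinate). -/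
theorem klpe_ext_periodic₁ (g : TorusSite 2 L → ℂ) (B K : ℝ) (x y : ℝ) : klpeExt g B K (x + 2 * π, y) = klpeExt g B K (x, y) := by
  unfold klpeExt
  rw [(klpe_extR_periodic _ B K x y).1, (klpe_extR_periodic _ B K x y).1]

/-- **Periodicity** (second coordinate). -/
theorem klpe_ext_periodic₂ (g : TorusSite 2 L → ℂ) (B K : ℝ) (x y : ℝ) : klpeExt g B K (x, y + 2 * π) = klpeExt g B K (x, y) := by
  unfold klpeExt
  rw [(klpe_extR_periodic _ B K x y).2, (klpe_extR_periodic _ B K x y).2]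

/-- **Continuity** (`0 ≤ K`). -/
theorem klpe_continuous_ext (g : TorusSite 2 L → ℂ) (B : ℝ) {K : ℝ} (hK : 0 ≤ K) : Continuous (klpeExt g B K) := by
  unfold klpeExt
  exact (Complex.continuous_ofReal.comp (klpe_continuous_extR _ B hK)).add
    ((Complex.continuous_ofReal.comp (klpe_continuous_extR _ B hK)).mul continuous_const)

/-- **PERIODIC LIPSCHITZ EXTENSION OF LATTICE DATA** (packaged): a function `g` on `TorusSite 2 L` with `‖g‖ ≤ B` and
`‖g k̃ − g k̃′‖ ≤ K·klTorusNorm L (k̃ − k̃′)` (`0 ≤ B`, `0 ≤ K`) is the restriction to the lattice momenta of a continuous, doubly `2π`-periodic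
function on `ℝ × ℝ` with sup `≤ 2B` and sup-metric Lipschitz constant `2K`. -/
theorem klpe_exists_periodic_lipschitz_extension (g : TorusSite 2 L → ℂ) {B K : ℝ} (hB : 0 ≤ B) (hK : 0 ≤ K) (hgB : ∀ k, ‖g k‖ ≤ B)
    (hg : ∀ k k', ‖g k - g k'‖ ≤ K * klTorusNorm L (k - k')) :
    ∃ G : ℝ × ℝ → ℂ, Continuous G ∧ (∀ x y, G (x + 2 * π, y) = G (x, y)) ∧ (∀ x y, G (x, y + 2 * π) = G (x, y)) ∧
      (∀ p, ‖G p‖ ≤ 2 * B) ∧ (∀ p q, ‖G p - G q‖ ≤ 2 * K * dist p q) ∧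
      ∀ k, G (latticeMomentum L k 0, latticeMomentum L k 1) = g k :=
  ⟨klpeExt g B K, klpe_continuous_ext g B hK, klpe_ext_periodic₁ g B K, klpe_ext_periodic₂ g B K, klpe_norm_ext_le g hB K,
    klpe_ext_lipschitz g B hK, klpe_ext_apply_latticeMomentum hgB hg⟩

end Complex

end Summit.HubbardSuperconductivity.HubbardSuperconductivity.Theorems.KLRegimeSplit

end
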